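import Summits.PneNP.PneNP.Theses.DescentTower

/-!
# Line `decomposition` — the BC2-redirect split of `ThreeColNotInP` (stmt-PneNP-2536) as a skeleton

`ThreeColNotInP` (3-COL ∉ P; Karp-equivalent to the summit) ⇐ `CaptureHom` (route item stmt-PneNP-17734,
NEW: capture restricted to homomorphism-monotone sound refuters) ∧ `JointSublinearFooling` (route item
stmt-PneNP-2538, crux B). The two stubs ARE the two pieces (route items, each with its own registered
skeleton: `Lines/capturehom_cpt.lean`, `Lines/sparse_support.lean`); the composition is the assembly
`CaptureHom → JointSublinearFooling → ThreeColNotInP` (= route item `ThreeColNotInPOfCaptureHom`,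
stmt-PneNP-17750, candidate proof attached there), proved here in full (sorry-free, 20 lines).
-/

set_option linter.dupNamespace false

namespace Summit.PneNP.PneNP.Cruxes.ThreeColNotInP.Decomposition

open Filter Summit.PneNP.PneNP.Theses.DescentTower

/-! ## The two stubs = the two pieces (route items, by name) -/

theorem stub_captureHom : CaptureHom := by
  sorry

theorem stub_jointSublinearFooling : JointSublinearFooling := by
  sorry

/-! ## Name-keyed aliases (hypotheses of the composition) -/
namespace Registered

/-- Alias of the route item `CaptureHom` keyed by the stub name. -/
abbrev stub_captureHom : Prop := CaptureHom
/-- Alias of the route item `JointSublinearFooling` keyed by the stub name. -/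
abbrev stub_jointSublinearFooling : Prop := JointSublinearFooling

end Registered

/-- COMPOSITION = the ASSEMBLY of the split (kernel-checked, no sorry): if `3-COL ∈ P` then the complement
`R` of the 3-COL language is a sound refuter in `P` (`compl_mem_P_iff`, `mem_toLanguage_iff`), and it is
homomorphism-monotone on codes (a 3-colouring of `H` pulls back along `G →g H`); `CaptureHom` gives a
sublinear `k` whose coupled level rejects every `R`-flagged graph for large `n`; `JointSublinearFooling`
at the same `k` supplies, for large `n`, a non-3-colourable (hence flagged) graph passing that level. -/
theorem ThreeColNotInP_of (hC : Registered.stub_captureHom) (hJ : Registered.stub_jointSublinearFooling) :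
    ThreeColNotInP := by
  unfold Registered.stub_captureHom CaptureHom at hC
  unfold Registered.stub_jointSublinearFooling JointSublinearFooling at hJ
  unfold ThreeColNotInP
  intro h3
  set L3 := Literature.Computability.Complexity.encodingGraph.toLanguage
    {G : Σ n, SimpleGraph (Fin n) | G.2.Colorable 3} with hL3
  have hR : L3ᶜ ∈ Literature.Computability.Complexity.Classes.P :=
    Literature.Computability.Complexity.compl_mem_P_iff.2 h3
  have hsound : ∀ (n : ℕ) (G : SimpleGraph (Fin n)),
      Literature.Computability.Complexity.encodingGraph.encode ⟨n, G⟩ ∈ L3ᶜ → ¬ G.Colorable 3 := by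
    intro n G hG hcol
    exact hG ((Computability.Encoding.mem_toLanguage_iff _ _ _).2 hcol)
  have hmono : ∀ (n m : ℕ) (G : SimpleGraph (Fin n)) (H : SimpleGraph (Fin m)), Nonempty (G →g H) →
      Literature.Computability.Complexity.encodingGraph.encode ⟨n, G⟩ ∈ L3ᶜ →
      Literature.Computability.Complexity.encodingGraph.encode ⟨m, H⟩ ∈ L3ᶜ := by
    intro n m G H hφ hG hH
    obtain ⟨φ⟩ := hφ
    have hHcol : H.Colorable 3 := (Computability.Encoding.mem_toLanguage_iff _ _ _).1 hH
    obtain ⟨C⟩ := hHcol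
    exact hG ((Computability.Encoding.mem_toLanguage_iff _ _ _).2 ⟨C.comp φ⟩)
  obtain ⟨k, hk, hcap⟩ := hC (L3ᶜ) hR hsound hmono
  obtain ⟨n, hn1, hn2⟩ := (hcap.and (hJ k hk)).exists
  obtain ⟨G, hGcol, hE⟩ := hn2
  have hGR : Literature.Computability.Complexity.encodingGraph.encode ⟨n, G⟩ ∈ L3ᶜ := fun hmem =>
    hGcol ((Computability.Encoding.mem_toLanguage_iff _ _ _).1 hmem)
  exact hn1 G hGR hE

end Summit.PneNP.PneNP.Cruxes.ThreeColNotInP.Decomposition
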